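import Mathlib
import HarnessLib
import Summits.HubbardSuperconductivity.HubbardSuperconductivity.Theorems.KLProgrammeC4aJetComparisonAll

/-!
# Route `KLProgramme` — crux C4a, S3 brick (B2, ALL ORDERS): the SHARP all-orders jet comparison — rows only up to the order
# `|∂ⁿ_t f(X + δ·Δ) − ∂ⁿ_t f(X)|₀ ≤ |δ|·(n+1)!·K·R·Dⁿ` with `‖X⁽ʲ⁾(0)‖ + |δ|‖Δ⁽ʲ⁾(0)‖ ≤ Dʲ` and `‖Δ⁽ʲ⁾(0)‖ ≤ R·Dʲ` for `j ≤ n` ONLY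

Cell `gate-hubbard-kl`, seat hubbard-kl-k3c3-p3 (g23; row «implicit-function / monotonicity route»).  Located brick «(B2)-TAN-ALL», sharpening of
`…C4aJetComparisonAll` for the (C)-closer lane hubbard-kl-c4a-1 (stub (C) `stub_twoLeg_curvature` of `KLRegimeEngineV17F2`,
stmt-HubbardSuperconductivity-20437; memo HOME/hubbard-kl-c4a-1/C4A-PLAN.md §24.8, §24.9).  `abs_iteratedDeriv_comp_add_smul_sub_le` bounds the
derivative `D^{n+1}(f∘Λ)(σ,0)[w, vⁿ]` of `σ ↦ ∂ⁿ_t|₀ f(X + σΔ)` by the full operator norm of `D^{n+1}(f∘Λ)`, which sees the pure jet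
`X⁽ⁿ⁺¹⁾ + σΔ⁽ⁿ⁺¹⁾` — one row more than the truth.  Here the slot `w` is moved INSIDE:

* `iteratedFDeriv_cons_line_eq_iteratedDeriv_fderiv` — `D^{n+1}P(x)[w, v, …, v] = ∂ⁿ_t|₀ (∂_w P)(x + tv)` for `P ∈ C^{n+1}` (induction with one
  Clairaut swap `iteratedFDeriv_succ_succ_apply_swap` per order — no general symmetry of `iteratedFDeriv` is needed);
* hence `d/dσ ∂ⁿ_t|₀ f(X + σΔ) = ∂ⁿ_t|₀ ( Df(X + σΔ)[Δ] )`, a one-variable Leibniz–chain expression in the jets `X⁽ʲ⁾(0), Δ⁽ʲ⁾(0)`, `j ≤ n`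
  (`norm_iteratedFDeriv_clm_apply`, `norm_iteratedFDeriv_comp_le` for `Df ∘ (X + σΔ)`, `C(n,i)·i! ≤ n!`);
* **`abs_iteratedDeriv_comp_add_smul_sub_le_sharp`** — `f ∈ C^{n+1}`, `‖Dⁱf‖ ≤ K` (`1 ≤ i ≤ n+1`), `X, Δ ∈ C^{n+1}`,
  `‖X⁽ʲ⁾(0)‖ + |δ|·‖Δ⁽ʲ⁾(0)‖ ≤ Dʲ` (`1 ≤ j ≤ n`), `‖Δ⁽ʲ⁾(0)‖ ≤ R·Dʲ` (`j ≤ n`) ⟹ `|∂ⁿ_t f(X + δ•Δ) − ∂ⁿ_t f(X)|₀ ≤ |δ|·(n+1)!·K·R·Dⁿ`.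

With it the `e → 0` / configuration reductions of the partner-band jets at order `k` need the radial rows only up to order `k` (in the tree for
`k ≤ 3`), see `…C4aPartnerBandTangencyDefectSharp`.  Pure calculus; nothing about the model's sizes; nothing asserts superconductivity.
References: FST II CPAM 51 (1998) §3; BGM 2006 §2.4 [cite: BenfattoGiulianiMastropietro2006].
-/

noncomputable section

namespace Summit.HubbardSuperconductivity.HubbardSuperconductivity.Theorems.C4a

set_option linter.dupNamespace false -- summit = problem name (single-conjunct summit), D-0017

open Real Set Filter Finset
open scoped Topology

section Sharp

variable {E F : Type*} [NormedAddCommGroup E] [NormedSpace ℝ E] [NormedAddCommGroup F] [NormedSpace ℝ F]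

/-- **`D^{n+1}P(x)[w, v, …, v] = ∂ⁿ_t|₀ (∂_w P)(x + tv)`** for `P ∈ C^{n+1}`: the outer slot `w` is moved inside by one Clairaut swap per order. -/
theorem iteratedFDeriv_cons_line_eq_iteratedDeriv_fderiv {P : E → F} {n : ℕ} {N : WithTop ℕ∞} (hP : ContDiff ℝ N P)
    (hn : ((n + 1 : ℕ) : WithTop ℕ∞) ≤ N) (x v w : E) :
    iteratedFDeriv ℝ (n + 1) P x (Fin.cons w (fun _ => v)) = iteratedDeriv n (fun t : ℝ => fderiv ℝ P (x + t • v) w) 0 := by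
  induction n generalizing x with
  | zero =>
    rw [iteratedDeriv_zero, iteratedFDeriv_one_apply]
    simp only [Fin.cons_zero, zero_smul, add_zero]
  | succ k ih =>
    have hk : ((k + 1 : ℕ) : WithTop ℕ∞) ≤ N := le_trans (by exact_mod_cast Nat.le_succ _) hn
    rw [const_eq_cons v k, iteratedFDeriv_succ_succ_apply_swap hP hn x w v _]
    have h1 : HasDerivAt (fun s : ℝ => iteratedFDeriv ℝ (k + 1) P (x + s • v) (Fin.cons w fun _ => v))
        (iteratedFDeriv ℝ (k + 2) P (x + (0 : ℝ) • v) (Fin.cons v (Fin.cons w fun _ => v))) 0 :=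
      hasDerivAt_iteratedFDeriv_line hP hn x v _ 0
    rw [zero_smul, add_zero] at h1
    rw [← h1.deriv]
    have h2 : (fun s : ℝ => iteratedFDeriv ℝ (k + 1) P (x + s • v) (Fin.cons w fun _ => v)) =
        fun s : ℝ => iteratedDeriv k (fun t : ℝ => fderiv ℝ P (x + t • v) w) s := by
      funext s
      rw [ih hk (x + s • v)]
      have e : (fun t : ℝ => fderiv ℝ P (x + s • v + t • v) w) = fun t : ℝ => (fun u : ℝ => fderiv ℝ P (x + u • v) w) (s + t) := by
        funext t; simp only [add_smul, add_assoc]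
      have h := congrFun (iteratedDeriv_comp_const_add k (fun u : ℝ => fderiv ℝ P (x + u • v) w) s) 0
      rw [e, h, add_zero]
    rw [h2, ← iteratedDeriv_succ]

/-- `C(n, i)·i! ≤ n!` (as reals). -/
theorem choose_mul_factorial_le_factorial (n i : ℕ) (hi : i ≤ n) : ((n.choose i : ℕ) : ℝ) * (i.factorial : ℝ) ≤ (n.factorial : ℝ) := by
  have h : n.choose i * i.factorial * (n - i).factorial = n.factorial := Nat.choose_mul_factorial_mul_factorial hi
  have h1 : 1 ≤ (n - i).factorial := Nat.one_le_iff_ne_zero.2 (Nat.factorial_ne_zero _)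
  have h2 : n.choose i * i.factorial ≤ n.factorial := by
    calc n.choose i * i.factorial = n.choose i * i.factorial * 1 := (mul_one _).symm
      _ ≤ n.choose i * i.factorial * (n - i).factorial := Nat.mul_le_mul_left _ h1
      _ = n.factorial := h
  exact_mod_cast h2

variable {V : Type*} [NormedAddCommGroup V] [NormedSpace ℝ V]

/-- **Leibniz–chain bound for `t ↦ Df(Y(t))[Δ(t)]` at a point**: `f ∈ C^{n+1}` with `‖Dⁱf‖ ≤ K` (`1 ≤ i ≤ n+1`), `‖Y⁽ʲ⁾(0)‖ ≤ Dʲ` (`1 ≤ j ≤ n`),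
`‖Δ⁽ʲ⁾(0)‖ ≤ R·Dʲ` (`j ≤ n`) ⟹ `‖∂ⁿ_t|₀ Df(Y(t))[Δ(t)]‖ ≤ (n+1)!·K·R·Dⁿ`. -/
theorem norm_iteratedDeriv_fderiv_comp_apply_le {f : V → ℝ} {n : ℕ} {N : WithTop ℕ∞} (hf : ContDiff ℝ N f)
    (hn : ((n + 1 : ℕ) : WithTop ℕ∞) ≤ N) {K : ℝ} (hK : ∀ i, 1 ≤ i → i ≤ n + 1 → ∀ x, ‖iteratedFDeriv ℝ i f x‖ ≤ K)
    {Y Δ : ℝ → V} (hY : ContDiff ℝ N Y) (hΔ : ContDiff ℝ N Δ) {D R : ℝ} (hD0 : 0 ≤ D) (hR0 : 0 ≤ R)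
    (hDY : ∀ j, 1 ≤ j → j ≤ n → ‖iteratedDeriv j Y 0‖ ≤ D ^ j) (hRΔ : ∀ j, j ≤ n → ‖iteratedDeriv j Δ 0‖ ≤ R * D ^ j) :
    ‖iteratedDeriv n (fun t : ℝ => fderiv ℝ f (Y t) (Δ t)) 0‖ ≤ (n + 1).factorial * K * R * D ^ n := by
  have hn1 : 1 ≤ n + 1 := by omega
  have hK0 : 0 ≤ K := (norm_nonneg _).trans (hK 1 le_rfl hn1 0)
  have hfN : ContDiff ℝ (n + 1 : ℕ) f := hf.of_le hn
  have hnN : ((n : ℕ) : WithTop ℕ∞) ≤ N := le_trans (by exact_mod_cast Nat.le_succ n) hn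
  have hYn : ContDiff ℝ (n : ℕ) Y := hY.of_le hnN
  have hΔn : ContDiff ℝ (n : ℕ) Δ := hΔ.of_le hnN
  -- `Df` is `Cⁿ` with `‖Dʲ(Df)‖ = ‖D^{j+1}f‖ ≤ K`
  have hDf : ContDiff ℝ (n : ℕ) (fderiv ℝ f) := hfN.fderiv_right (by push_cast; exact le_rfl)
  have hcomp : ContDiff ℝ (n : ℕ) (fun t : ℝ => fderiv ℝ f (Y t)) := hDf.comp hYn
  -- Leibniz for the evaluation `(Df ∘ Y)(t) (Δ t)`
  rw [← norm_iteratedFDeriv_eq_norm_iteratedDeriv]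
  refine (norm_iteratedFDeriv_clm_apply hcomp hΔn 0 le_rfl).trans ?_
  -- each term: `C(n,i)·‖Dⁱ(Df∘Y)(0)‖·‖D^{n-i}Δ(0)‖ ≤ C(n,i)·(i!·K·Dⁱ)·(R·D^{n-i}) ≤ n!·K·R·Dⁿ`
  have hterm : ∀ i ∈ Finset.range (n + 1), ((n.choose i : ℕ) : ℝ) * ‖iteratedFDeriv ℝ i (fun t : ℝ => fderiv ℝ f (Y t)) 0‖ *
      ‖iteratedFDeriv ℝ (n - i) Δ 0‖ ≤ (n.factorial : ℝ) * K * R * D ^ n := by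
    intro i hi
    have hin : i ≤ n := Nat.lt_succ_iff.1 (Finset.mem_range.1 hi)
    have hiN : ((i : ℕ) : WithTop ℕ∞) ≤ (n : ℕ) := by exact_mod_cast hin
    -- chain bound for `Df ∘ Y` at order `i`
    have hchain : ‖iteratedFDeriv ℝ i (fun t : ℝ => fderiv ℝ f (Y t)) 0‖ ≤ (i.factorial : ℝ) * K * D ^ i := by
      have h := norm_iteratedFDeriv_comp_le (g := fderiv ℝ f) (f := Y) hDf hYn hiN 0 (C := K) (D := D)
        (fun j hj => by
          rw [norm_iteratedFDeriv_fderiv]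
          exact hK (j + 1) (by omega) (by omega) _)
        (fun j hj1 hj => by
          rw [norm_iteratedFDeriv_eq_norm_iteratedDeriv]
          exact hDY j hj1 (hj.trans hin))
      exact h
    have hΔi : ‖iteratedFDeriv ℝ (n - i) Δ 0‖ ≤ R * D ^ (n - i) := by
      rw [norm_iteratedFDeriv_eq_norm_iteratedDeriv]; exact hRΔ (n - i) (by omega)
    have hcf := choose_mul_factorial_le_factorial n i hin
    have hpow : D ^ i * D ^ (n - i) = D ^ n := by rw [← pow_add, Nat.add_sub_cancel' hin]
    calc ((n.choose i : ℕ) : ℝ) * ‖iteratedFDeriv ℝ i (fun t : ℝ => fderiv ℝ f (Y t)) 0‖ * ‖iteratedFDeriv ℝ (n - i) Δ 0‖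
        ≤ ((n.choose i : ℕ) : ℝ) * ((i.factorial : ℝ) * K * D ^ i) * (R * D ^ (n - i)) := by gcongr
      _ = (((n.choose i : ℕ) : ℝ) * (i.factorial : ℝ)) * K * R * (D ^ i * D ^ (n - i)) := by ring
      _ ≤ (n.factorial : ℝ) * K * R * (D ^ i * D ^ (n - i)) := by gcongr
      _ = (n.factorial : ℝ) * K * R * D ^ n := by rw [hpow]
  refine (Finset.sum_le_sum hterm).trans ?_
  rw [Finset.sum_const, Finset.card_range, nsmul_eq_mul, Nat.factorial_succ]
  push_cast
  ring_nf
  exact le_rfl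

/-- **THE SHARP ALL-ORDERS JET COMPARISON.**  `f ∈ C^{n+1}` with `‖Dⁱf‖ ≤ K` (`1 ≤ i ≤ n+1`); `X, Δ : ℝ → V` of class `C^{n+1}`; `δ ∈ ℝ`; `D, R ≥ 0` with
`‖X⁽ʲ⁾(0)‖ + |δ|·‖Δ⁽ʲ⁾(0)‖ ≤ Dʲ` for `1 ≤ j ≤ n` and `‖Δ⁽ʲ⁾(0)‖ ≤ R·Dʲ` for `j ≤ n`.  Then
`|∂ⁿ_t|₀ f(X(t) + δ•Δ(t)) − ∂ⁿ_t|₀ f(X(t))| ≤ |δ|·(n+1)!·K·R·Dⁿ` — ONLY JETS OF ORDER `≤ n` enter.  (Mean value in `σ ∈ [0,δ]`; the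
`σ`-derivative of `∂ⁿ_t|₀ f(X + σΔ)` is `∂ⁿ_t|₀ (Df(X + σΔ)[Δ])` by `iteratedFDeriv_cons_line_eq_iteratedDeriv_fderiv`.) [folklore] -/
theorem abs_iteratedDeriv_comp_add_smul_sub_le_sharp {f : V → ℝ} {n : ℕ} {N : WithTop ℕ∞} (hf : ContDiff ℝ N f)
    (hn : ((n + 1 : ℕ) : WithTop ℕ∞) ≤ N) {K : ℝ} (hK : ∀ i, 1 ≤ i → i ≤ n + 1 → ∀ x, ‖iteratedFDeriv ℝ i f x‖ ≤ K)
    {X Δ : ℝ → V} (hX : ContDiff ℝ N X) (hΔ : ContDiff ℝ N Δ) (δ : ℝ) {D R : ℝ} (hD0 : 0 ≤ D) (hR0 : 0 ≤ R)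
    (hD : ∀ j, 1 ≤ j → j ≤ n → ‖iteratedDeriv j X 0‖ + |δ| * ‖iteratedDeriv j Δ 0‖ ≤ D ^ j)
    (hR : ∀ j, j ≤ n → ‖iteratedDeriv j Δ 0‖ ≤ R * D ^ j) :
    |iteratedDeriv n (fun t : ℝ => f (X t + δ • Δ t)) 0 - iteratedDeriv n (fun t : ℝ => f (X t)) 0| ≤
      |δ| * ((n + 1).factorial * K * R * D ^ n) := by
  have hn1 : 1 ≤ n + 1 := by omega
  have hfN : ContDiff ℝ (n + 1 : ℕ) f := hf.of_le hn
  have hXN : ContDiff ℝ (n + 1 : ℕ) X := hX.of_le hn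
  have hΔN : ContDiff ℝ (n + 1 : ℕ) Δ := hΔ.of_le hn
  have hnn : ((n : ℕ) : WithTop ℕ∞) ≤ (n + 1 : ℕ) := by exact_mod_cast Nat.le_succ n
  have hfd : Differentiable ℝ f := hfN.differentiable (by exact_mod_cast (show n + 1 ≠ 0 by omega))
  have hXd : Differentiable ℝ X := hXN.differentiable (by exact_mod_cast (show n + 1 ≠ 0 by omega))
  have hΔd : Differentiable ℝ Δ := hΔN.differentiable (by exact_mod_cast (show n + 1 ≠ 0 by omega))
  -- the two-variable function `P(σ, t) = f(X(t) + σΔ(t))`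
  set Λ : ℝ × ℝ → V := fun x => X (ContinuousLinearMap.snd ℝ ℝ ℝ x) +
    (ContinuousLinearMap.fst ℝ ℝ ℝ x) • Δ (ContinuousLinearMap.snd ℝ ℝ ℝ x) with hΛ
  set P : ℝ × ℝ → ℝ := fun x => f (Λ x) with hP
  have hΛ1 : ContDiff ℝ (n + 1 : ℕ) (fun x : ℝ × ℝ => X (ContinuousLinearMap.snd ℝ ℝ ℝ x)) := hXN.comp (ContinuousLinearMap.snd ℝ ℝ ℝ).contDiff
  have hΛ2 : ContDiff ℝ (n + 1 : ℕ) (fun x : ℝ × ℝ => (ContinuousLinearMap.fst ℝ ℝ ℝ x) • Δ (ContinuousLinearMap.snd ℝ ℝ ℝ x)) :=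
    (ContinuousLinearMap.fst ℝ ℝ ℝ).contDiff.smul (hΔN.comp (ContinuousLinearMap.snd ℝ ℝ ℝ).contDiff)
  have hΛc : ContDiff ℝ (n + 1 : ℕ) Λ := hΛ1.add hΛ2
  have hPc : ContDiff ℝ (n + 1 : ℕ) P := hfN.comp hΛc
  set q : ℝ × ℝ := (0, 0) with hq
  set v : ℝ × ℝ := (0, 1) with hv
  set w : ℝ × ℝ := (1, 0) with hw
  have hline : ∀ σ t : ℝ, q + σ • w + t • v = (σ, t) := fun σ t => by
    rw [hq, hv, hw]; refine Prod.ext ?_ ?_ <;> simp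
  -- `g(σ) = Dⁿ P(σ,0)[vⁿ] = ∂ⁿ_t|₀ f(X + σΔ)`
  have hg_eq : ∀ σ : ℝ, iteratedFDeriv ℝ n P (q + σ • w) (fun _ => v) = iteratedDeriv n (fun t : ℝ => f (X t + σ • Δ t)) 0 := fun σ => by
    have h := iteratedDeriv_comp_line P hPc hnn (q + σ • w) v 0
    rw [zero_smul, add_zero] at h
    rw [← h]
    congr 1
    funext t
    simp only [hline σ t, hP, hΛ, ContinuousLinearMap.coe_fst', ContinuousLinearMap.coe_snd']
  have hg : ∀ σ : ℝ, HasDerivAt (fun σ : ℝ => iteratedFDeriv ℝ n P (q + σ • w) (fun _ => v))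
      (iteratedFDeriv ℝ (n + 1) P (q + σ • w) (Fin.cons w fun _ => v)) σ := fun σ => hasDerivAt_iteratedFDeriv_line hPc le_rfl q w _ σ
  -- `∂_w P(σ, t) = Df(X(t) + σΔ(t))[Δ(t)]`
  have hPw : ∀ σ t : ℝ, fderiv ℝ P (q + σ • w + t • v) w = fderiv ℝ f (X t + σ • Δ t) (Δ t) := fun σ t => by
    rw [hline σ t]
    set x : ℝ × ℝ := (σ, t) with hx
    set TX : ℝ →L[ℝ] V := ContinuousLinearMap.toSpanSingleton ℝ (deriv X t) with hTX
    set TΔ : ℝ →L[ℝ] V := ContinuousLinearMap.toSpanSingleton ℝ (deriv Δ t) with hTΔ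
    have ha : HasFDerivAt (fun y : ℝ × ℝ => X (ContinuousLinearMap.snd ℝ ℝ ℝ y)) (TX.comp (ContinuousLinearMap.snd ℝ ℝ ℝ)) x := by
      have h := ((hXd _).hasDerivAt.hasFDerivAt).comp x (ContinuousLinearMap.snd ℝ ℝ ℝ).hasFDerivAt
      exact h
    have hb : HasFDerivAt (fun y : ℝ × ℝ => Δ (ContinuousLinearMap.snd ℝ ℝ ℝ y)) (TΔ.comp (ContinuousLinearMap.snd ℝ ℝ ℝ)) x := by
      have h := ((hΔd _).hasDerivAt.hasFDerivAt).comp x (ContinuousLinearMap.snd ℝ ℝ ℝ).hasFDerivAt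
      exact h
    have hc : HasFDerivAt (fun y : ℝ × ℝ => (ContinuousLinearMap.fst ℝ ℝ ℝ y) • Δ (ContinuousLinearMap.snd ℝ ℝ ℝ y))
        ((ContinuousLinearMap.fst ℝ ℝ ℝ x) • (TΔ.comp (ContinuousLinearMap.snd ℝ ℝ ℝ)) +
          (ContinuousLinearMap.fst ℝ ℝ ℝ).smulRight (Δ (ContinuousLinearMap.snd ℝ ℝ ℝ x))) x :=
      (ContinuousLinearMap.fst ℝ ℝ ℝ).hasFDerivAt.smul hb
    have hΛd : HasFDerivAt Λ (TX.comp (ContinuousLinearMap.snd ℝ ℝ ℝ) + ((ContinuousLinearMap.fst ℝ ℝ ℝ x) • (TΔ.comp (ContinuousLinearMap.snd ℝ ℝ ℝ)) +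
          (ContinuousLinearMap.fst ℝ ℝ ℝ).smulRight (Δ (ContinuousLinearMap.snd ℝ ℝ ℝ x)))) x := ha.add hc
    have hPd := (hfd (Λ x)).hasFDerivAt.comp x hΛd
    rw [show P = f ∘ Λ from rfl, hPd.fderiv]
    simp [hw, hx, hTX, hTΔ, hΛ, ContinuousLinearMap.toSpanSingleton_apply]
  -- the derivative `g′(σ) = ∂ⁿ_t|₀ Df(X + σΔ)[Δ]` and its bound on `[0, δ]`
  have hbound : ∀ σ ∈ uIcc (0 : ℝ) δ, ‖iteratedFDeriv ℝ (n + 1) P (q + σ • w) (Fin.cons w fun _ => v)‖ ≤ (n + 1).factorial * K * R * D ^ n := by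
    intro σ hσ
    have hσδ : |σ| ≤ |δ| := abs_le_abs_of_mem_uIcc_zero hσ
    rw [iteratedFDeriv_cons_line_eq_iteratedDeriv_fderiv hPc le_rfl (q + σ • w) v w]
    have hfun : (fun t : ℝ => fderiv ℝ P (q + σ • w + t • v) w) = fun t : ℝ => fderiv ℝ f (X t + σ • Δ t) (Δ t) := funext (hPw σ)
    rw [hfun, Real.norm_eq_abs, ← Real.norm_eq_abs]
    have hYc : ContDiff ℝ N (fun t : ℝ => X t + σ • Δ t) := hX.add (hΔ.const_smul σ)
    refine norm_iteratedDeriv_fderiv_comp_apply_le hf hn hK hYc hΔ hD0 hR0 (fun j hj1 hj => ?_) hR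
    -- `‖(X + σΔ)⁽ʲ⁾(0)‖ ≤ ‖X⁽ʲ⁾(0)‖ + |σ|‖Δ⁽ʲ⁾(0)‖ ≤ Dʲ`
    have hjN : ((j : ℕ) : WithTop ℕ∞) ≤ (n + 1 : ℕ) := by exact_mod_cast (hj.trans (Nat.le_succ n))
    have hXj : ContDiffAt ℝ j X 0 := (hXN.of_le hjN).contDiffAt
    have hΔj : ContDiffAt ℝ j Δ 0 := (hΔN.of_le hjN).contDiffAt
    have hsΔj : ContDiffAt ℝ j (fun t : ℝ => σ • Δ t) 0 := hΔj.const_smul σ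
    rw [iteratedDeriv_fun_add hXj hsΔj, show (fun t : ℝ => σ • Δ t) = σ • Δ from rfl, iteratedDeriv_const_smul hΔj]
    refine (norm_add_le _ _).trans ?_
    rw [norm_smul, Real.norm_eq_abs]
    have := hD j hj1 hj
    nlinarith [norm_nonneg (iteratedDeriv j Δ 0), abs_nonneg σ]
  -- mean value on `[0, δ]`
  have hMVT := (convex_uIcc (0 : ℝ) δ).norm_image_sub_le_of_norm_hasDerivWithin_le
    (f := fun σ : ℝ => iteratedFDeriv ℝ n P (q + σ • w) (fun _ => v)) (fun σ _ => (hg σ).hasDerivWithinAt) hbound left_mem_uIcc right_mem_uIcc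
  rw [hg_eq δ, hg_eq 0, sub_zero, Real.norm_eq_abs, Real.norm_eq_abs] at hMVT
  have e0 : (fun t : ℝ => f (X t + (0 : ℝ) • Δ t)) = fun t : ℝ => f (X t) := by funext t; rw [zero_smul, add_zero]
  rw [e0] at hMVT
  linarith [hMVT, mul_comm (|δ|) ((n + 1).factorial * K * R * D ^ n)]

end Sharp

end Summit.HubbardSuperconductivity.HubbardSuperconductivity.Theorems.C4a

end
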